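import Summits.ResolutionOfSingularities.ResolutionOfSingularities.Theorems.HilbertSamuelEliminationCampaignW42ToricMarkedMonomialCase

/-!
# [OURS · L1 W4.2] Toric marked monomial objects in dimension 3 — RESIDUAL ORDERS, maximal-contact rays, admissible faces

[OURS · L1 W4.2 · seat res-L1-s42-pv-2 gen 5] Level-1 machinery of the existence proof of `IdeasL1Idea2R8.InitialCornerSolvable`
(«procedure Q», memo `L/res-L1-s42-pv-2/CALIBRATION-W42-O2-v4.md` §3 (F0)–(F2)) on the model `…CampaignW42ToricMarkedDefs`:
the full toric factorisation `J = M · I` (`β`, residual exponents `α = a − β ≥ 0`), the residual order `θ_R = min_v Σ_R α_r(v)` along a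
face (Blanco's E-order of the non-monomial part), the set `K(C)` of E-MAXIMAL-CONTACT rays of a corner (supports of the residual
minimisers), ADMISSIBLE faces (full residual order + the companion's monomial condition), and the three structural facts: admissible faces
are legal and contain `K`; under the blow-up of a face of full residual order no child's residual order exceeds the parent's; a child
that replaces a maximal-contact ray has strictly smaller residual order.  Replaces the role of Blanco 2012 I Lem 3.31 / Prop 3.28 (monomial
form); NOT a statement of the manuscript under review, nor of Blanco / Encinas–Villamayor.  AI work, weaker than expert review.  Pure
definitions + proofs, no `sorry`, no new axiom.
-/

set_option linter.dupNamespace false -- mandated namespace of this single-conjunct summit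

namespace Summit.ResolutionOfSingularities.ResolutionOfSingularities.Theorems.CampaignW42.Toric

namespace TState

open Finset

variable {ι : Type} [Fintype ι] [Nonempty ι]

section Residual

/-- **[OURS · L1 W4.2]** Residual exponent `α_r(v) := a_r(v) − β_r ≥ 0` (exponent of generator `v` in the non-monomial part `I`
of the full toric factorisation `J = M · I`). -/
def alpha (s : TState ι) (r : ℕ) (v : ι) : ℤ := s.expo r v - s.beta r

/-- **[OURS · L1 W4.2]** `Σ_{r∈R} α_r(v)`: the order of the residual part of generator `v` along the face `R`. -/
def alphaSum (s : TState ι) (R : Finset ℕ) (v : ι) : ℤ := ∑ r ∈ R, s.alpha r v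

/-- **[OURS · L1 W4.2]** RESIDUAL ORDER along the face `R`: `θ_R := min_v Σ_R α_r(v)` (E-order of `I` along the stratum of `R`;
`θ_C = 0` iff the corner `C` is principal). -/
def thetaR (s : TState ι) (R : Finset ℕ) : ℤ := Finset.univ.inf' Finset.univ_nonempty (fun v => s.alphaSum R v)

/-- Residual exponents are non-negative. -/
theorem alpha_nonneg (s : TState ι) (r : ℕ) (v : ι) : 0 ≤ s.alpha r v := by
  unfold alpha; have := s.beta_le r v; omega

/-- At every ray some generator has residual exponent `0`. -/
theorem exists_alpha_eq_zero (s : TState ι) (r : ℕ) : ∃ v, s.alpha r v = 0 := by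
  obtain ⟨v, hv⟩ := s.exists_beta_eq r; exact ⟨v, by unfold alpha; omega⟩

/-- `Σ_R α(v) = Σ_R a(v) − Σ_R β`. -/
theorem alphaSum_eq (s : TState ι) (R : Finset ℕ) (v : ι) : s.alphaSum R v = s.faceSum R v - s.betaSum R := by
  unfold alphaSum alpha faceSum betaSum
  rw [Finset.sum_sub_distrib]

/-- Residual orders along faces are non-negative sums. -/
theorem alphaSum_nonneg (s : TState ι) (R : Finset ℕ) (v : ι) : 0 ≤ s.alphaSum R v :=
  Finset.sum_nonneg (fun r _ => s.alpha_nonneg r v)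

/-- Residual sums are monotone in the face. -/
theorem alphaSum_mono (s : TState ι) {R R' : Finset ℕ} (h : R ⊆ R') (v : ι) : s.alphaSum R v ≤ s.alphaSum R' v :=
  Finset.sum_le_sum_of_subset_of_nonneg h (fun r _ _ => s.alpha_nonneg r v)

/-- `θ_R ≤ Σ_R α(v)` for every generator. -/
theorem thetaR_le (s : TState ι) (R : Finset ℕ) (v : ι) : s.thetaR R ≤ s.alphaSum R v :=
  Finset.inf'_le _ (Finset.mem_univ v)

/-- `θ_R` is attained by some generator (a residual minimiser along `R`). -/
theorem exists_thetaR_eq (s : TState ι) (R : Finset ℕ) : ∃ v, s.alphaSum R v = s.thetaR R := by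
  obtain ⟨v, -, hv⟩ := Finset.exists_mem_eq_inf' (s := (Finset.univ : Finset ι)) Finset.univ_nonempty (fun v => s.alphaSum R v)
  exact ⟨v, hv.symm⟩

/-- A lower bound valid for every generator bounds `θ_R` from below. -/
theorem le_thetaR_of_forall (s : TState ι) (R : Finset ℕ) (z : ℤ) (h : ∀ v, z ≤ s.alphaSum R v) : z ≤ s.thetaR R := by
  obtain ⟨v, hv⟩ := s.exists_thetaR_eq R; rw [← hv]; exact h v

/-- Residual orders are non-negative. -/
theorem thetaR_nonneg (s : TState ι) (R : Finset ℕ) : 0 ≤ s.thetaR R :=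
  s.le_thetaR_of_forall R 0 (fun v => s.alphaSum_nonneg R v)

/-- Residual orders are monotone in the face. -/
theorem thetaR_mono (s : TState ι) {R R' : Finset ℕ} (h : R ⊆ R') : s.thetaR R ≤ s.thetaR R' :=
  s.le_thetaR_of_forall R' _ (fun v => (s.thetaR_le R v).trans (s.alphaSum_mono h v))

/-- A corner has residual order `0` iff it is principal. -/
theorem thetaR_eq_zero_iff_principal (s : TState ι) (C : Finset ℕ) : s.thetaR C = 0 ↔ s.Principal C := by
  constructor
  · intro h
    obtain ⟨v₀, hv₀⟩ := s.exists_thetaR_eq C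
    rw [h] at hv₀
    refine ⟨v₀, fun v r hr => ?_⟩
    have hz : s.alpha r v₀ = 0 := by
      have hle : s.alpha r v₀ ≤ s.alphaSum C v₀ :=
        Finset.single_le_sum (fun r' _ => s.alpha_nonneg r' v₀) hr
      have := s.alpha_nonneg r v₀
      omega
    unfold alpha at hz
    have := s.beta_le r v
    omega
  · rintro ⟨v₀, hv₀⟩
    apply le_antisymm _ (s.thetaR_nonneg C)
    refine (s.thetaR_le C v₀).trans (le_of_eq ?_)
    apply Finset.sum_eq_zero
    intro r hr
    unfold alpha
    have h1 := s.beta_le r v₀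
    obtain ⟨v, hv⟩ := s.exists_beta_eq r
    have h2 := hv₀ v r hr
    omega

end Residual

section MaxContact

/-- **[OURS · L1 W4.2]** `v` is a residual MINIMISER of the corner `C`: `Σ_C α(v) = θ_C`. -/
def IsMinimizer (s : TState ι) (C : Finset ℕ) (v : ι) : Prop := s.alphaSum C v = s.thetaR C

open Classical in
/-- **[OURS · L1 W4.2]** The set `K(C)` of E-MAXIMAL-CONTACT rays of the corner `C`: rays at which some residual minimiser has a positive
residual exponent (union of the supports of the minimisers). -/
noncomputable def Kset (s : TState ι) (C : Finset ℕ) : Finset ℕ :=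
  C.filter (fun r => ∃ v, s.IsMinimizer C v ∧ 0 < s.alpha r v)

omit [Fintype ι] [Nonempty ι] in
/-- A positive finite sum of integers has a positive term. -/
private theorem sum_pos_exists {R : Finset ℕ} {f : ℕ → ℤ} (h : 0 < ∑ r ∈ R, f r) :
    ∃ r ∈ R, 0 < f r := by
  by_contra hne
  push Not at hne
  have : ∑ r ∈ R, f r ≤ 0 := Finset.sum_nonpos (fun r hr => hne r hr)
  omega

/-- Membership in `K(C)`. -/
theorem mem_Kset {s : TState ι} {C : Finset ℕ} {r : ℕ} :
    r ∈ s.Kset C ↔ r ∈ C ∧ ∃ v, s.IsMinimizer C v ∧ 0 < s.alpha r v := by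
  classical
  unfold Kset; rw [Finset.mem_filter]

/-- `K(C) ⊆ C`. -/
theorem Kset_subset (s : TState ι) (C : Finset ℕ) : s.Kset C ⊆ C := fun _ hr => (mem_Kset.mp hr).1

/-- A corner with positive residual order has a maximal-contact ray (Blanco I Lem 3.31, monomial form). -/
theorem Kset_nonempty {s : TState ι} {C : Finset ℕ} (h : 0 < s.thetaR C) : (s.Kset C).Nonempty := by
  obtain ⟨v, hv⟩ := s.exists_thetaR_eq C
  have hpos : 0 < s.alphaSum C v := by rw [hv]; exact h
  obtain ⟨r, hr, hpr⟩ := sum_pos_exists hpos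
  exact ⟨r, mem_Kset.mpr ⟨hr, v, hv, hpr⟩⟩

/-- The support of a residual minimiser lies in `K(C)`. -/
theorem mem_Kset_of_minimizer {s : TState ι} {C : Finset ℕ} {v : ι} (hv : s.IsMinimizer C v) {r : ℕ} (hr : r ∈ C)
    (hpos : 0 < s.alpha r v) : r ∈ s.Kset C :=
  mem_Kset.mpr ⟨hr, v, hv, hpos⟩

/-- **(F2a)** A face of full residual order inside a corner contains every maximal-contact ray of that corner. -/
theorem Kset_subset_of_full {s : TState ι} {C R : Finset ℕ} (hRC : R ⊆ C) (hfull : s.thetaR C ≤ s.thetaR R) :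
    s.Kset C ⊆ R := by
  intro r hr
  obtain ⟨hrC, v, hv, hpos⟩ := mem_Kset.mp hr
  by_contra hrR
  -- Σ_R α(v) ≤ Σ_C α(v) − α_r(v) < θ_C ≤ θ_R ≤ Σ_R α(v)
  have h1 : s.alpha r v + s.alphaSum R v ≤ s.alphaSum C v := by
    unfold alphaSum
    rw [← Finset.sum_insert (f := fun x => s.alpha x v) hrR]
    exact Finset.sum_le_sum_of_subset_of_nonneg (Finset.insert_subset hrC hRC) (fun r' _ _ => s.alpha_nonneg r' v)
  have h2 := s.thetaR_le R v
  unfold IsMinimizer at hv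
  omega

end MaxContact

section Admissible

/-- **[OURS · L1 W4.2]** ADMISSIBLE face in the phase of residual order `θs` (`0 < θs`): a face with `θ_R = θs` and, when `θs < m`, with
monomial part `Σ_R β ≥ m − θs` (permissibility for the companion `I + M^{θs/(m−θs)}`). -/
def Admissible (m : ℕ) (s : TState ι) (θs : ℤ) (R : Finset ℕ) : Prop :=
  s.IsFace R ∧ s.thetaR R = θs ∧ (θs < m → (m : ℤ) - θs ≤ s.betaSum R)

/-- `β_r ≥ 0` in a non-negative state. -/
theorem beta_nonneg {s : TState ι} (hs : s.Nonneg) (r : ℕ) : 0 ≤ s.beta r := by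
  obtain ⟨v, hv⟩ := s.exists_beta_eq r; rw [hv]; exact hs r v

/-- `Σ_R β ≥ 0` in a non-negative state. -/
theorem betaSum_nonneg {s : TState ι} (hs : s.Nonneg) (R : Finset ℕ) : 0 ≤ s.betaSum R :=
  Finset.sum_nonneg (fun r _ => beta_nonneg hs r)

/-- Admissible faces are legal (non-negative state, positive phase value). -/
theorem Admissible.legal {m : ℕ} {s : TState ι} (hs : s.Nonneg) {θs : ℤ} {R : Finset ℕ} (h : s.Admissible m θs R) :
    s.Legal m R := by
  refine ⟨h.1, fun v => ?_⟩
  have h1 := s.alphaSum_eq R v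
  have h2 := s.thetaR_le R v
  have h3 := h.2.1
  have h5 := betaSum_nonneg hs R
  by_cases hlt : θs < m
  · have h4 := h.2.2 hlt; omega
  · omega

/-- **(F2a')** An admissible face inside a corner of the phase's residual order contains all its maximal-contact rays. -/
theorem Admissible.Kset_subset {m : ℕ} {s : TState ι} {θs : ℤ} {R C : Finset ℕ} (h : s.Admissible m θs R) (hRC : R ⊆ C)
    (hC : s.thetaR C = θs) : s.Kset C ⊆ R :=
  Kset_subset_of_full hRC (by rw [hC, h.2.1])

end Admissible


section Moves

/-- **(F0)** `β` of the new ray: `β_ρ = Σ_R β + θ_R − m`. -/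
theorem beta_move_next (m : ℕ) (s : TState ι) (R : Finset ℕ) :
    (s.move m R).beta s.next = s.betaSum R + s.thetaR R - m := by
  apply le_antisymm
  · obtain ⟨v, hv⟩ := s.exists_thetaR_eq R
    refine ((s.move m R).beta_le s.next v).trans (le_of_eq ?_)
    rw [move_expo_next, ← hv, alphaSum_eq]; ring
  · unfold beta
    refine Finset.le_inf' _ _ (fun v _ => ?_)
    rw [move_expo_next]
    have h1 := s.alphaSum_eq R v
    have h2 := s.thetaR_le R v
    omega

/-- **(F0)** Residual exponents of the new ray: `α_ρ(v) = Σ_R α(v) − θ_R`. -/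
theorem alpha_move_next (m : ℕ) (s : TState ι) (R : Finset ℕ) (v : ι) :
    (s.move m R).alpha s.next v = s.alphaSum R v - s.thetaR R := by
  unfold alpha
  rw [beta_move_next, move_expo_next, alphaSum_eq]; ring

/-- **(F0)** Residual exponents of old rays are unchanged. -/
theorem alpha_move_of_ne {m : ℕ} {s : TState ι} {R : Finset ℕ} {r : ℕ} (hr : r ≠ s.next) (v : ι) :
    (s.move m R).alpha r v = s.alpha r v := by
  unfold alpha; rw [move_expo_of_ne hr, beta_move_of_ne hr]

/-- Residual sums of faces avoiding the new ray are unchanged. -/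
theorem alphaSum_move_of_not_mem {m : ℕ} {s : TState ι} {R D : Finset ℕ} (hD : s.next ∉ D) (v : ι) :
    (s.move m R).alphaSum D v = s.alphaSum D v :=
  Finset.sum_congr rfl (fun _ hr => alpha_move_of_ne (fun h => hD (h ▸ hr)) v)

/-- Residual orders of faces avoiding the new ray are unchanged. -/
theorem thetaR_move_of_not_mem {m : ℕ} {s : TState ι} {R D : Finset ℕ} (hD : s.next ∉ D) :
    (s.move m R).thetaR D = s.thetaR D := by
  unfold thetaR
  exact congrArg _ (funext (fun v => alphaSum_move_of_not_mem hD v))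

/-- **(F0)** Residual sum of a child `(C ∖ x) ∪ {ρ}`: parent's, minus the replaced ray, plus `Σ_R α − θ_R`. -/
theorem alphaSum_child {m : ℕ} {s : TState ι} {R C : Finset ℕ} {x : ℕ} (hx : x ∈ C) (hC : s.next ∉ C) (v : ι) :
    (s.move m R).alphaSum (insert s.next (C.erase x)) v = s.alphaSum C v - s.alpha x v + (s.alphaSum R v - s.thetaR R) := by
  unfold alphaSum
  have h1 : s.next ∉ C.erase x := fun h => hC (Finset.mem_of_mem_erase h)
  rw [Finset.sum_insert h1, alpha_move_next]
  have h2 : ∑ r ∈ C.erase x, (s.move m R).alpha r v = ∑ r ∈ C.erase x, s.alpha r v :=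
    Finset.sum_congr rfl (fun r hr => alpha_move_of_ne (fun h => h1 (h ▸ hr)) v)
  rw [h2, ← Finset.add_sum_erase C (fun r => s.alpha r v) hx]
  unfold alphaSum
  ring

/-- **(F1) No increase of the residual order.**  If `R ⊆ C` has residual order at least that of `C` (in a phase: `θ_R = θ* ≥ θ_C`),
every child of `C` has residual order `≤ θ_C`. -/
theorem thetaR_child_le {m : ℕ} {s : TState ι} {R C : Finset ℕ} (hRC : R ⊆ C) (hθ : s.thetaR C ≤ s.thetaR R) {x : ℕ}
    (hx : x ∈ C) (hC : s.next ∉ C) :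
    (s.move m R).thetaR (insert s.next (C.erase x)) ≤ s.thetaR C := by
  obtain ⟨v, hv⟩ := s.exists_thetaR_eq C
  refine ((s.move m R).thetaR_le _ v).trans ?_
  rw [alphaSum_child hx hC v, hv]
  have h1 := s.alphaSum_mono hRC v
  have h2 := s.alpha_nonneg x v
  omega

/-- **(F2b) Maximal contact.**  Under the same hypothesis, the child replacing a MAXIMAL-CONTACT ray of `C` has strictly smaller
residual order. -/
theorem thetaR_child_lt_of_mem_Kset {m : ℕ} {s : TState ι} {R C : Finset ℕ} (hRC : R ⊆ C) (hθ : s.thetaR C ≤ s.thetaR R)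
    {x : ℕ} (hx : x ∈ s.Kset C) (hC : s.next ∉ C) :
    (s.move m R).thetaR (insert s.next (C.erase x)) < s.thetaR C := by
  obtain ⟨hxC, v, hv, hpos⟩ := mem_Kset.mp hx
  refine lt_of_le_of_lt ((s.move m R).thetaR_le _ v) ?_
  unfold IsMinimizer at hv
  rw [alphaSum_child hxC hC v, hv]
  have h1 := s.alphaSum_mono hRC v
  omega

/-- **(F2c) Persistence of minimisers / growth of `K`.**  If the child replacing a NON-maximal-contact ray `x` of `C` keeps the
residual order of `C`, it keeps every maximal-contact ray of `C` as a maximal-contact ray. -/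
theorem Kset_subset_Kset_child {m : ℕ} {s : TState ι} {R C : Finset ℕ} (hRC : R ⊆ C) (hθ : s.thetaR C ≤ s.thetaR R)
    {x : ℕ} (hxC : x ∈ C) (hxK : x ∉ s.Kset C) (hC : s.next ∉ C)
    (hkeep : (s.move m R).thetaR (insert s.next (C.erase x)) = s.thetaR C) :
    s.Kset C ⊆ (s.move m R).Kset (insert s.next (C.erase x)) := by
  intro r hr
  obtain ⟨hrC, v, hv, hpos⟩ := mem_Kset.mp hr
  unfold IsMinimizer at hv
  -- `x` is not in the support of the minimiser `v`
  have hx0 : s.alpha x v = 0 := by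
    by_contra hne
    have : 0 < s.alpha x v := lt_of_le_of_ne (s.alpha_nonneg x v) (Ne.symm hne)
    exact hxK (mem_Kset.mpr ⟨hxC, v, hv, this⟩)
  have hrx : r ≠ x := fun h => by rw [h, hx0] at hpos; exact lt_irrefl _ hpos
  have hrn : r ≠ s.next := fun h => hC (h ▸ hrC)
  -- `v` stays a minimiser of the child
  have hRv : s.alphaSum R v = s.thetaR R :=
    le_antisymm ((s.alphaSum_mono hRC v).trans (by rw [hv]; exact hθ)) (s.thetaR_le R v)
  have hmin : (s.move m R).IsMinimizer (insert s.next (C.erase x)) v := by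
    unfold IsMinimizer
    rw [hkeep, alphaSum_child hxC hC v, hv, hx0, hRv]; ring
  refine mem_Kset.mpr ⟨Finset.mem_insert_of_mem (Finset.mem_erase.mpr ⟨hrx, hrC⟩), v, hmin, ?_⟩
  rw [alpha_move_of_ne hrn]; exact hpos

end Moves

end TState

end Summit.ResolutionOfSingularities.ResolutionOfSingularities.Theorems.CampaignW42.Toric
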